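import Mathlib
import Literature.NumberTheory.LFunctions.Zhang2022.Section7cProofs
import Literature.NumberTheory.Sieve.BombieriAsymptoticSieveShiftedPrimes
import HarnessLib

/-!
# Zhang (2022) §7, proof of Proposition 7.1 part (b): the dyadic assembly
# "(7.13) ∧ [terms `1 < r < D`] ∧ (7.15) ⇒ (7.11)" — DISCHARGED as a kernel edge

Topic `Literature/NumberTheory/LFunctions/Zhang2022` (Landau–Siegel audit tree; verdict-neutral).
Y. Zhang, *Discrete mean estimates and the Landau–Siegel zero*, arXiv:2211.02515v1 (2022)
[Zhang2022LandauSiegel] — **an unrefereed manuscript under adjudication**. D-0069 campaign, cell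
`siegel-zhang`, layer L2, cone leaf C18 (`Skeleton.Ded71`), "*Proof of Proposition 7.1: The error
term*" (§7 pp. 37–39, tex L1984–L2058). The manuscript bounds `Σ_{p∼P} p^{β₃}𝔗₁₂(p)` by (7.13),
`≪ Σ′_{d,h,r} (dhφ(hr)√r)⁻¹ Σ*_{θ mod r}|𝔰(r,h,d;θ)|` over `dhr < P₁`, `r > 1`; states that "the
total contribution from the terms with `1 < r < D` is `O(P²D^{−c})`" (tex L2022); and concludes
"The proof of (7.11) is therefore reduced to showing that
`R^{−3/2} Σ_{R≤r<2R} Σ*_{θ mod r}|𝔰(r,h,d;θ)| ≪ τ₅(d)hP²D^{−c}` (7.15) for `dh < P₁` and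
`D ≤ R < (dh)⁻¹P₁`" (tex L2024–L2030). The reduction — the dyadic decomposition of `r ≥ D`, the
weights `(dhφ(hr)√r)⁻¹` against `R^{−3/2}`, the sums over `d, h` and over the `O(𝓛⁹)` dyadic blocks,
and `P²D^{−c}(log)^{O(1)} = o(𝔓)` — is left to the reader.

This file PROVES it, against slice L2-t4's typed nodes (`Section7cStatements`, p412159):
`eq711_of : Eq713 c′ → Step7bSmallR c′ → Eq715 c′ → Iface.Eq711 c′` (and the owner's form
`Section7bStatements.Eq711 c′`, `eq711'_of`), i.e. the last edge of the deduction node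
`DedProp71b` (`Z22:Prop7.1.pf.b-error`). Ingredients: `d/φ(d) ≤ (1 + log d)²` (tree:
`Literature.NumberTheory.Sieve.natCast_div_totient_le`), the harmonic bound, the tree's divisor-sum
majorant `MeanSquareMajorant.sum_div_le` for `Σ τ₅(d)/d`, and the size of `𝔓` (tree:
`frakP_bounds`, (2.9)). Theorems only; 0 new definitions; 0 new facts. `Step7bSmallR` (the terms
`1 < r < D`) and (7.15) stay HYPOTHESES (the former is gap-ledger territory, G-adj2-1).

WHAT THIS IS NOT: any claim about Theorems 1–2 of the manuscript or about Landau–Siegel zeros; not a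
proof of (7.11), (7.13), (7.15) or of the `1 < r < D` bound themselves.

## References

* Y. Zhang, arXiv:2211.02515v1 (2022), §7 (7.11) p. 37 tex L1980; (7.13)–(7.15) pp. 37–38,
  tex L2005–L2030; (2.9) p. 4. [cite: Zhang2022LandauSiegel, §7 (7.13)–(7.15) pp.37–38]
-/

noncomputable section

open Finset Real

namespace Literature.NumberTheory.LFunctions.Zhang2022.Section7cStatements

open Literature.NumberTheory.LFunctions.Zhang2022.Skeleton

open scoped Classical

/-! ## Elementary tools -/

/-- `𝓛^k · D^{−c} → 0`: for every `k`, `c > 0`, `η > 0` and `K`, eventually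
`K·𝓛^k·D^{−c} ≤ η` (`𝓛 = log D`). [folklore] -/
private theorem ell_pow_mul_rpow_neg_eventually (k : ℕ) {c : ℝ} (hc : 0 < c) {η : ℝ} (hη : 0 < η)
    (K : ℝ) : ∃ D₀ : ℕ, ∀ D : ℕ, D₀ ≤ D → K * ell D ^ k * (D : ℝ) ^ (-c) ≤ η := by
  -- `x^k ≤ k!(2/c)^k e^{cx/2}` for `x ≥ 0`, so `K x^k e^{−cx} ≤ K k!(2/c)^k e^{−cx/2}`
  set K' : ℝ := max K 0 with hK'
  set A : ℝ := K' * (Nat.factorial k : ℝ) * (2 / c) ^ k with hA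
  have hA0 : 0 ≤ A := by positivity
  -- threshold: `e^{−cx/2} ≤ η/(A+1)` once `x ≥ (2/c)·log((A+1)/η)`
  set x₀ : ℝ := max 0 (2 / c * Real.log ((A + 1) / η)) with hx₀
  refine ⟨⌈Real.exp x₀⌉₊, fun D hD => ?_⟩
  have hexpD : Real.exp x₀ ≤ D := le_trans (Nat.le_ceil _) (by exact_mod_cast hD)
  have hDpos : (0 : ℝ) < D := lt_of_lt_of_le (Real.exp_pos _) hexpD
  have hx : x₀ ≤ ell D := by
    rw [ell]; exact (Real.le_log_iff_exp_le hDpos).mpr hexpD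
  have hℓ0 : 0 ≤ ell D := le_trans (le_max_left _ _) hx
  -- `D^{-c} = exp(-c 𝓛)`
  have hrpow : (D : ℝ) ^ (-c) = Real.exp (-(c * ell D)) := by
    rw [Real.rpow_def_of_pos hDpos, ell]; ring_nf
  -- `𝓛^k ≤ k! (2/c)^k exp(c𝓛/2)`
  have hpow : ell D ^ k ≤ (Nat.factorial k : ℝ) * (2 / c) ^ k * Real.exp (c * ell D / 2) := by
    have h := Real.pow_div_factorial_le_exp (c * ell D / 2) (by positivity) k
    have hk : (0 : ℝ) < Nat.factorial k := by exact_mod_cast Nat.factorial_pos k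
    rw [div_le_iff₀ hk] at h
    have hc2 : (c * ell D / 2) ^ k = (c / 2) ^ k * ell D ^ k := by rw [← mul_pow]; ring
    rw [hc2] at h
    have hcpos : 0 < (c / 2) ^ k := by positivity
    calc ell D ^ k = (c / 2) ^ k * ell D ^ k * ((c / 2) ^ k)⁻¹ := by
          field_simp
      _ ≤ Real.exp (c * ell D / 2) * Nat.factorial k * ((c / 2) ^ k)⁻¹ :=
          mul_le_mul_of_nonneg_right h (by positivity)
      _ = (Nat.factorial k : ℝ) * (2 / c) ^ k * Real.exp (c * ell D / 2) := by
          rw [show ((c / 2) ^ k)⁻¹ = (2 / c) ^ k by rw [← inv_pow, inv_div]]; ring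
  -- the tail `exp(-c𝓛/2) ≤ η/(A+1)`
  have htail : Real.exp (-(c * ell D / 2)) ≤ η / (A + 1) := by
    have h1 : 2 / c * Real.log ((A + 1) / η) ≤ ell D := le_trans (le_max_right _ _) hx
    have h2 : Real.log ((A + 1) / η) ≤ c * ell D / 2 := by
      have := mul_le_mul_of_nonneg_left h1 (show 0 ≤ c / 2 by positivity)
      calc Real.log ((A + 1) / η) = c / 2 * (2 / c * Real.log ((A + 1) / η)) := by
            field_simp
        _ ≤ c / 2 * ell D := this
        _ = c * ell D / 2 := by ring
    calc Real.exp (-(c * ell D / 2)) ≤ Real.exp (-Real.log ((A + 1) / η)) :=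
          Real.exp_le_exp.mpr (neg_le_neg h2)
      _ = η / (A + 1) := by
          rw [Real.exp_neg, Real.exp_log (by positivity), inv_div]
  calc K * ell D ^ k * (D : ℝ) ^ (-c)
      ≤ K' * ell D ^ k * (D : ℝ) ^ (-c) :=
        mul_le_mul_of_nonneg_right (mul_le_mul_of_nonneg_right (le_max_left _ _)
          (pow_nonneg hℓ0 _)) (Real.rpow_nonneg hDpos.le _)
    _ ≤ K' * ((Nat.factorial k : ℝ) * (2 / c) ^ k * Real.exp (c * ell D / 2)) *
          (D : ℝ) ^ (-c) :=
        mul_le_mul_of_nonneg_right (mul_le_mul_of_nonneg_left hpow (le_max_right _ _))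
          (Real.rpow_nonneg hDpos.le _)
    _ = A * (Real.exp (c * ell D / 2) * Real.exp (-(c * ell D))) := by rw [hrpow, hA]; ring
    _ = A * Real.exp (-(c * ell D / 2)) := by rw [← Real.exp_add]; ring_nf
    _ ≤ A * (η / (A + 1)) := mul_le_mul_of_nonneg_left htail hA0
    _ ≤ η := by
        rw [mul_div_assoc']
        rw [div_le_iff₀ (by positivity)]
        nlinarith

/-- The harmonic bound `Σ_{1≤h<N} 1/h ≤ 1 + log N`. [folklore] -/
private theorem sum_Ico_inv_le_one_add_log (N : ℕ) :
    ∑ h ∈ Finset.Ico 1 N, (1 : ℝ) / h ≤ 1 + Real.log N := by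
  rcases Nat.lt_or_ge N 2 with hN | hN
  · interval_cases N
    · simp
    · simp
  have hIco : Finset.Ico 1 N = Finset.Icc 1 (N - 1) := by
    ext h; simp only [Finset.mem_Ico, Finset.mem_Icc]; omega
  have h1 : ∑ h ∈ Finset.Icc 1 (N - 1), (1 : ℝ) / h = (harmonic (N - 1) : ℝ) := by
    rw [harmonic_eq_sum_Icc]; push_cast
    exact Finset.sum_congr rfl fun h _ => by rw [one_div]
  rw [hIco, h1]
  have h2 := harmonic_le_one_add_log (N - 1)
  have h3 : Real.log ((N - 1 : ℕ) : ℝ) ≤ Real.log N :=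
    Real.log_le_log (by exact_mod_cast (by omega : 0 < N - 1)) (by exact_mod_cast Nat.sub_le N 1)
  linarith

/-- The divisor-function majorant `Σ_{1≤d<N} τ₅(d)/d ≤ M₅ (log N)^5`, `M₅ = majorantConst 5 5`,
for `N ≥ 3` (the tree's Hall–Tenenbaum majorant `MeanSquareMajorant.sum_div_le`).
[cite: HallTenenbaum1988, (0.4)] -/
theorem sum_Ico_tau_five_div_le {N : ℕ} (hN : 3 ≤ N) :
    ∑ d ∈ Finset.Ico 1 N, MeanSquareMajorant.tau 5 d / d ≤
      MeanSquareMajorant.majorantConst 5 5 * Real.log N ^ 5 := by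
  have hIco : Finset.Ico 1 N = Finset.Icc 1 (N - 1) := by
    ext h; simp only [Finset.mem_Ico, Finset.mem_Icc]; omega
  have hmul := MeanSquareMajorant.isMultiplicative_tau 5
  have h := MeanSquareMajorant.sum_div_le (f := fun n => MeanSquareMajorant.tau 5 n)
    (a := 5) (d := 5) (K := 0)
    (MeanSquareMajorant.tau_apply_one 5) (fun m n hmn => hmul.map_mul_of_coprime hmn)
    (fun n => MeanSquareMajorant.tau_nonneg 5 n) le_rfl
    (fun p hp => by rw [MeanSquareMajorant.tau_prime 5 hp]; norm_num)
    (fun p ν hp => MeanSquareMajorant.tau_prime_pow_le 5 hp ν) (X := N - 1) (by omega)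
  simp only [zero_mul, Real.exp_zero, mul_one] at h
  rw [hIco]
  refine h.trans ?_
  have hlog : Real.log ((N - 1 : ℕ) : ℝ) ≤ Real.log N :=
    Real.log_le_log (by exact_mod_cast (by omega : 0 < N - 1)) (by exact_mod_cast Nat.sub_le N 1)
  have hlog0 : 0 ≤ Real.log ((N - 1 : ℕ) : ℝ) := Real.log_natCast_nonneg _
  exact mul_le_mul_of_nonneg_left (pow_le_pow_left₀ hlog0 hlog 5)
    (MeanSquareMajorant.majorantConst_pos 5 5).le

/-- The dyadic block of `r ≥ D ≥ 1`: with `i = ⌊log₂(r/D)⌋` and `R = D·2^i`, `R ≤ r < 2R`, i.e.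
`r ∈ dyadic R`. [folklore] -/
private theorem mem_dyadic_of_log_eq {D r : ℕ} (hD : 0 < D) (hDr : D ≤ r) :
    r ∈ dyadic (((D * 2 ^ Nat.log 2 (r / D) : ℕ) : ℝ)) := by
  set i := Nat.log 2 (r / D) with hi
  have hq : r / D ≠ 0 := (Nat.div_pos hDr hD).ne'
  have h1 : D * 2 ^ i ≤ r := by
    have := Nat.pow_log_le_self 2 hq
    calc D * 2 ^ i ≤ D * (r / D) := Nat.mul_le_mul_left _ this
      _ ≤ r := Nat.mul_div_le r D
  have h2 : r < 2 * (D * 2 ^ i) := by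
    have := Nat.lt_pow_succ_log_self (b := 2) (by norm_num) (r / D)
    rw [Nat.div_lt_iff_lt_mul hD, pow_succ] at this
    calc r < 2 ^ i * 2 * D := this
      _ = 2 * (D * 2 ^ i) := by ring
  rw [dyadic, Finset.mem_filter, Finset.mem_range]
  have h1' : ((D * 2 ^ i : ℕ) : ℝ) ≤ r := by exact_mod_cast h1
  have h2' : (r : ℝ) < 2 * ((D * 2 ^ i : ℕ) : ℝ) := by exact_mod_cast h2
  refine ⟨?_, h1', h2'⟩
  rw [Nat.lt_ceil]
  exact h2'

/-- The weight of (7.13) on a dyadic block: for `1 ≤ d`, `1 ≤ h`, `R ≤ r`, `0 < R` and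
`hr ≤ M` (`M ≥ 1`), `(dhφ(hr)√r)⁻¹ ≤ (1 + log M)²/(d h² R√R)` (`n/φ(n) ≤ (1 + log n)²`).
[cite: Zhang2022LandauSiegel, §7 (7.13) p.37] -/
theorem weight713_le {d h r : ℕ} {R M : ℝ} (hd : 0 < d) (hh : 0 < h) (hR : 0 < R)
    (hRr : R ≤ r) (hM : ((h * r : ℕ) : ℝ) ≤ M) (hr : 0 < r) :
    (((d * h : ℕ) : ℝ) * (Nat.totient (h * r) : ℝ) * Real.sqrt r)⁻¹ ≤
      (1 + Real.log M) ^ 2 / ((d : ℝ) * (h : ℝ) ^ 2 * (R * Real.sqrt R)) := by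
  have hhr : 0 < h * r := Nat.mul_pos hh hr
  have hφ : 0 < (Nat.totient (h * r) : ℝ) := by exact_mod_cast Nat.totient_pos.mpr hhr
  have hsqr : 0 < Real.sqrt r := Real.sqrt_pos.mpr (by exact_mod_cast hr)
  have hsqR : 0 < Real.sqrt R := Real.sqrt_pos.mpr hR
  have hM1 : (1 : ℝ) ≤ M := le_trans (by exact_mod_cast hhr) hM
  -- `hr ≤ (1 + log(hr))² φ(hr) ≤ (1 + log M)² φ(hr)`
  have hkey : ((h * r : ℕ) : ℝ) ≤ (1 + Real.log M) ^ 2 * (Nat.totient (h * r) : ℝ) := by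
    have h1 := Literature.NumberTheory.Sieve.natCast_div_totient_le (h * r)
    rw [div_le_iff₀ hφ] at h1
    refine h1.trans (mul_le_mul_of_nonneg_right ?_ hφ.le)
    have hl0 : 0 ≤ 1 + Real.log ((h * r : ℕ) : ℝ) := by
      have := Real.log_natCast_nonneg (h * r); linarith
    exact pow_le_pow_left₀ hl0 (by
      have := Real.log_le_log (by exact_mod_cast hhr) hM; linarith) 2
  rw [inv_eq_one_div, div_le_div_iff₀ (by positivity) (by positivity), one_mul]
  -- goal: `d h² R√R ≤ (1+log M)² (dh φ(hr) √r)`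
  have hRr' : R * Real.sqrt R ≤ (r : ℝ) * Real.sqrt r :=
    mul_le_mul hRr (Real.sqrt_le_sqrt hRr) hsqR.le (by positivity)
  calc (d : ℝ) * (h : ℝ) ^ 2 * (R * Real.sqrt R)
      ≤ (d : ℝ) * (h : ℝ) ^ 2 * ((r : ℝ) * Real.sqrt r) := by gcongr
    _ = (d : ℝ) * h * (((h * r : ℕ) : ℝ) * Real.sqrt r) := by push_cast; ring
    _ ≤ (d : ℝ) * h * ((1 + Real.log M) ^ 2 * (Nat.totient (h * r) : ℝ) * Real.sqrt r) := by
        gcongr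
    _ = (1 + Real.log M) ^ 2 * (((d * h : ℕ) : ℝ) * (Nat.totient (h * r) : ℝ) * Real.sqrt r) := by
        push_cast; ring

/-- `R^{−3/2} = (R√R)⁻¹` for `R > 0`. [folklore] -/
private theorem rpow_neg_three_halves {R : ℝ} (hR : 0 < R) :
    R ^ (-(3 / 2 : ℝ)) = (R * Real.sqrt R)⁻¹ := by
  rw [Real.rpow_neg hR.le, show (3 / 2 : ℝ) = 1 + 1 / 2 by norm_num,
    Real.rpow_add hR, Real.rpow_one, Real.sqrt_eq_rpow]

/-! ## The dyadic blocks of `r ≥ D` for fixed `d, h` -/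

/-- **One dyadic block.** For `1 ≤ d, h < ⌈P₁⌉` and a block index `i` (`R = D·2^i`): the part of the
(7.13)-sum over `r ∈ [R, 2R)` with `dhr < P₁`, `r ≥ D` is at most
`Λ·C₃τ₅(d)P²D^{−c₃}/(dh)`, `Λ = (1 + log⌈P₁⌉²)²`, GIVEN the (7.15)-bound for this `D` (the weight
`(dhφ(hr)√r)⁻¹ ≤ Λ/(dh²R√R)` cancels the `R^{3/2}` and one `h`).
[cite: Zhang2022LandauSiegel, §7 (7.13)–(7.15) pp.37–38, tex L2005–L2030] -/
theorem fiber713_le (c' : ℝ) {D : ℕ} (a₁ : ℕ → ℂ) {C₃ c₃ : ℝ} (hC₃ : 0 ≤ C₃) (hD : 0 < D)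
    (h715D : ∀ (d h : ℕ) (R : ℝ), 0 < d → 0 < h → InRange735 D d h R →
      R ^ (-(3 / 2 : ℝ)) * ∑ r ∈ dyadic R, ∑ θ : DirichletCharacter ℂ r,
          (if θ.IsPrimitive then ‖frakS c' D a₁ r h d θ‖ else 0) ≤
        C₃ * MeanSquareMajorant.tau 5 d * (h : ℝ) * bigP D ^ 2 * (D : ℝ) ^ (-c₃))
    {d h : ℕ} (hd : d ∈ Finset.Ico 1 ⌈Skeleton.P1 D⌉₊) (hh : h ∈ Finset.Ico 1 ⌈Skeleton.P1 D⌉₊) (i : ℕ) :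
    ∑ r ∈ ((Finset.Ico 2 ⌈Skeleton.P1 D⌉₊).filter
        (fun r => ((d * h * r : ℕ) : ℝ) < Skeleton.P1 D ∧ ¬ r < D)).filter (fun r => Nat.log 2 (r / D) = i),
        term713 c' D a₁ (d, h, r) ≤
      (1 + Real.log ((((⌈Skeleton.P1 D⌉₊ : ℕ) : ℝ)) ^ 2)) ^ 2 * C₃ * MeanSquareMajorant.tau 5 d *
        bigP D ^ 2 * (D : ℝ) ^ (-c₃) / ((d : ℝ) * h) := by
  rw [Finset.mem_Ico] at hd hh
  set N₁ : ℕ := ⌈Skeleton.P1 D⌉₊ with hN₁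
  set Λ : ℝ := (1 + Real.log (((N₁ : ℕ) : ℝ) ^ 2)) ^ 2 with hΛ
  set R : ℝ := ((D * 2 ^ i : ℕ) : ℝ) with hR
  set F := ((Finset.Ico 2 N₁).filter
    (fun r => ((d * h * r : ℕ) : ℝ) < Skeleton.P1 D ∧ ¬ r < D)).filter (fun r => Nat.log 2 (r / D) = i)
    with hF
  set V : ℕ → ℝ := fun r => ∑ θ : DirichletCharacter ℂ r,
    (if θ.IsPrimitive then ‖frakS c' D a₁ r h d θ‖ else 0) with hV
  have hV0 : ∀ r, 0 ≤ V r := fun r => Finset.sum_nonneg fun θ _ => by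
    split_ifs
    · exact norm_nonneg _
    · exact le_rfl
  have hd0 : (0 : ℝ) < d := by exact_mod_cast hd.1
  have hh0 : (0 : ℝ) < h := by exact_mod_cast hh.1
  have hRpos : 0 < R := by rw [hR]; exact_mod_cast Nat.mul_pos hD (pow_pos two_pos i)
  have hτ0 : 0 ≤ MeanSquareMajorant.tau 5 d := MeanSquareMajorant.tau_nonneg 5 d
  have hΦ0 : 0 ≤ Λ * C₃ * MeanSquareMajorant.tau 5 d * bigP D ^ 2 * (D : ℝ) ^ (-c₃) / ((d : ℝ) * h) := by
    positivity
  -- members of the fiber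
  have hmem : ∀ r ∈ F, 2 ≤ r ∧ r < N₁ ∧ ((d * h * r : ℕ) : ℝ) < Skeleton.P1 D ∧ D ≤ r ∧
      r ∈ dyadic R := by
    intro r hr
    rw [hF, Finset.mem_filter, Finset.mem_filter, Finset.mem_Ico] at hr
    obtain ⟨⟨⟨h2, hN⟩, hP, hDr⟩, hlog⟩ := hr
    push Not at hDr
    refine ⟨h2, hN, hP, hDr, ?_⟩
    rw [hR, ← hlog]
    exact mem_dyadic_of_log_eq hD hDr
  by_cases hne : F = ∅
  · rw [hne, Finset.sum_empty]; exact hΦ0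
  obtain ⟨r₀, hr₀⟩ := Finset.nonempty_of_ne_empty hne
  obtain ⟨h2₀, -, hP₀, -, hdy₀⟩ := hmem r₀ hr₀
  -- the range condition of (7.15) for `R`
  have hRr₀ : R ≤ r₀ := by
    have := (Finset.mem_filter.mp hdy₀).2.1; exact this
  have hrange : InRange735 D d h R := by
    have hdh : (0 : ℝ) < ((d * h : ℕ) : ℝ) := by push_cast; positivity
    have hP₀' : ((d * h : ℕ) : ℝ) * r₀ < Skeleton.P1 D := by push_cast at hP₀ ⊢; linarith
    refine ⟨?_, ?_, ?_⟩
    · have h1 : (1 : ℝ) ≤ r₀ := by exact_mod_cast (by omega : 1 ≤ r₀)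
      nlinarith
    · rw [hR]; exact_mod_cast Nat.le_mul_of_pos_right D (pow_pos two_pos i)
    · rw [lt_div_iff₀ hdh]
      calc R * ((d * h : ℕ) : ℝ) ≤ r₀ * ((d * h : ℕ) : ℝ) :=
            mul_le_mul_of_nonneg_right hRr₀ hdh.le
        _ = ((d * h : ℕ) : ℝ) * r₀ := mul_comm _ _
        _ < Skeleton.P1 D := hP₀'
  -- (7.15) on this block: `Σ_{dyadic R} V ≤ R√R · C₃τ₅(d)hP²D^{-c₃}`
  have h715 := h715D d h R hd.1 hh.1 hrange
  rw [rpow_neg_three_halves hRpos] at h715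
  have hRR : 0 < R * Real.sqrt R := mul_pos hRpos (Real.sqrt_pos.mpr hRpos)
  have hblock : ∑ r ∈ dyadic R, V r ≤
      R * Real.sqrt R * (C₃ * MeanSquareMajorant.tau 5 d * (h : ℝ) * bigP D ^ 2 * (D : ℝ) ^ (-c₃)) := by
    rw [inv_mul_le_iff₀ hRR] at h715
    exact h715
  -- the weight bound on the fiber and the comparison with the full dyadic block
  have hw : ∀ r ∈ F, term713 c' D a₁ (d, h, r) ≤ Λ / ((d : ℝ) * (h : ℝ) ^ 2 * (R * Real.sqrt R)) * V r := by
    intro r hr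
    obtain ⟨h2, hN, -, -, hdy⟩ := hmem r hr
    have hRr : R ≤ r := (Finset.mem_filter.mp hdy).2.1
    have hM : ((h * r : ℕ) : ℝ) ≤ ((N₁ : ℕ) : ℝ) ^ 2 := by
      have : h * r ≤ N₁ * N₁ := Nat.mul_le_mul hh.2.le hN.le
      calc ((h * r : ℕ) : ℝ) ≤ ((N₁ * N₁ : ℕ) : ℝ) := by exact_mod_cast this
        _ = ((N₁ : ℕ) : ℝ) ^ 2 := by push_cast; ring
    have hwt := weight713_le (d := d) (h := h) (r := r) hd.1 hh.1 hRpos hRr hM (by omega)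
    unfold term713
    exact mul_le_mul_of_nonneg_right hwt (hV0 r)
  calc ∑ r ∈ F, term713 c' D a₁ (d, h, r)
      ≤ ∑ r ∈ F, Λ / ((d : ℝ) * (h : ℝ) ^ 2 * (R * Real.sqrt R)) * V r := Finset.sum_le_sum hw
    _ = Λ / ((d : ℝ) * (h : ℝ) ^ 2 * (R * Real.sqrt R)) * ∑ r ∈ F, V r := by
        rw [Finset.mul_sum]
    _ ≤ Λ / ((d : ℝ) * (h : ℝ) ^ 2 * (R * Real.sqrt R)) * ∑ r ∈ dyadic R, V r := by
        refine mul_le_mul_of_nonneg_left ?_ (by positivity)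
        exact Finset.sum_le_sum_of_subset_of_nonneg (fun r hr => (hmem r hr).2.2.2.2)
          (fun r _ _ => hV0 r)
    _ ≤ Λ / ((d : ℝ) * (h : ℝ) ^ 2 * (R * Real.sqrt R)) *
          (R * Real.sqrt R * (C₃ * MeanSquareMajorant.tau 5 d * (h : ℝ) * bigP D ^ 2 *
            (D : ℝ) ^ (-c₃))) := mul_le_mul_of_nonneg_left hblock (by positivity)
    _ = Λ * C₃ * MeanSquareMajorant.tau 5 d * bigP D ^ 2 * (D : ℝ) ^ (-c₃) / ((d : ℝ) * h) := by
        field_simp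

/-- **All dyadic blocks for fixed `d, h`**: the part of the (7.13)-sum over `r ≥ D` (with `dhr < P₁`,
`2 ≤ r < ⌈P₁⌉`) is at most `(I+1)·Λ·C₃τ₅(d)P²D^{−c₃}/(dh)`, `I = ⌊log₂⌈P₁⌉⌋` (at most `I + 1` dyadic
blocks), GIVEN the (7.15)-bound for this `D`.
[cite: Zhang2022LandauSiegel, §7 (7.13)–(7.15) pp.37–38, tex L2005–L2030] -/
theorem blocks713_le (c' : ℝ) {D : ℕ} (a₁ : ℕ → ℂ) {C₃ c₃ : ℝ} (hC₃ : 0 ≤ C₃) (hD : 0 < D)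
    (h715D : ∀ (d h : ℕ) (R : ℝ), 0 < d → 0 < h → InRange735 D d h R →
      R ^ (-(3 / 2 : ℝ)) * ∑ r ∈ dyadic R, ∑ θ : DirichletCharacter ℂ r,
          (if θ.IsPrimitive then ‖frakS c' D a₁ r h d θ‖ else 0) ≤
        C₃ * MeanSquareMajorant.tau 5 d * (h : ℝ) * bigP D ^ 2 * (D : ℝ) ^ (-c₃))
    {d h : ℕ} (hd : d ∈ Finset.Ico 1 ⌈Skeleton.P1 D⌉₊) (hh : h ∈ Finset.Ico 1 ⌈Skeleton.P1 D⌉₊) :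
    ∑ r ∈ (Finset.Ico 2 ⌈Skeleton.P1 D⌉₊).filter
        (fun r => ((d * h * r : ℕ) : ℝ) < Skeleton.P1 D ∧ ¬ r < D), term713 c' D a₁ (d, h, r) ≤
      ((Nat.log 2 ⌈Skeleton.P1 D⌉₊ : ℕ) + 1 : ℝ) *
        ((1 + Real.log ((((⌈Skeleton.P1 D⌉₊ : ℕ) : ℝ)) ^ 2)) ^ 2 * C₃ * MeanSquareMajorant.tau 5 d *
          bigP D ^ 2 * (D : ℝ) ^ (-c₃) / ((d : ℝ) * h)) := by
  set N₁ : ℕ := ⌈Skeleton.P1 D⌉₊ with hN₁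
  set I : ℕ := Nat.log 2 N₁ with hI
  set B' := (Finset.Ico 2 N₁).filter (fun r => ((d * h * r : ℕ) : ℝ) < Skeleton.P1 D ∧ ¬ r < D)
    with hB'
  -- every `r ∈ B'` falls in a block `i ≤ I`
  have hmaps : ∀ r ∈ B', Nat.log 2 (r / D) ∈ Finset.range (I + 1) := by
    intro r hr
    rw [hB', Finset.mem_filter, Finset.mem_Ico] at hr
    rw [Finset.mem_range, Nat.lt_succ_iff, hI]
    exact Nat.log_mono_right (le_trans (Nat.div_le_self r D) hr.1.2.le)
  rw [← Finset.sum_fiberwise_of_maps_to hmaps]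
  have hfib : ∀ i ∈ Finset.range (I + 1),
      ∑ r ∈ B'.filter (fun r => Nat.log 2 (r / D) = i), term713 c' D a₁ (d, h, r) ≤
        (1 + Real.log ((((⌈Skeleton.P1 D⌉₊ : ℕ) : ℝ)) ^ 2)) ^ 2 * C₃ * MeanSquareMajorant.tau 5 d *
          bigP D ^ 2 * (D : ℝ) ^ (-c₃) / ((d : ℝ) * h) :=
    fun i _ => fiber713_le c' a₁ hC₃ hD h715D hd hh i
  refine (Finset.sum_le_sum hfib).trans ?_
  rw [Finset.sum_const, Finset.card_range, nsmul_eq_mul]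
  push_cast
  rfl

/-! ## The assembly (7.13) ∧ [`1 < r < D`] ∧ (7.15) ⇒ (7.11) -/

/-- `log⌈P₁⌉ ≤ 𝓛⁹` and `3 ≤ ⌈P₁⌉` once `𝓛 ≥ 2` (`P₁ = P^{0.504} = exp(0.504𝓛⁹)`).
[cite: Zhang2022LandauSiegel, §2 (2.21) p.10] -/
theorem log_ceil_P1_le {D : ℕ} (hℓ : 2 ≤ ell D) :
    Real.log (((⌈Skeleton.P1 D⌉₊ : ℕ) : ℝ)) ≤ ell D ^ 9 ∧ 3 ≤ ⌈Skeleton.P1 D⌉₊ := by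
  have hP1 : Skeleton.P1 D = Real.exp (0.504 * ell D ^ 9) := by
    rw [Skeleton.P1, bigP, ← Real.exp_mul, mul_comm]
  have hℓ9 : (512 : ℝ) ≤ ell D ^ 9 := by
    calc (512 : ℝ) = 2 ^ 9 := by norm_num
      _ ≤ ell D ^ 9 := pow_le_pow_left₀ (by norm_num) hℓ 9
  have hP1ge : (3 : ℝ) ≤ Skeleton.P1 D := by
    rw [hP1]
    have : (3 : ℝ) ≤ Real.exp 2 := by
      have := Real.add_one_le_exp (2 : ℝ); linarith
    exact this.trans (Real.exp_le_exp.mpr (by linarith))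
  have hN3 : 3 ≤ ⌈Skeleton.P1 D⌉₊ := by
    have := Nat.le_ceil (Skeleton.P1 D)
    exact_mod_cast hP1ge.trans this
  refine ⟨?_, hN3⟩
  have hceil : ((⌈Skeleton.P1 D⌉₊ : ℕ) : ℝ) ≤ 2 * Skeleton.P1 D := by
    have := Nat.ceil_lt_add_one (show 0 ≤ Skeleton.P1 D by rw [hP1]; exact (Real.exp_pos _).le)
    linarith
  have hpos : (0 : ℝ) < ((⌈Skeleton.P1 D⌉₊ : ℕ) : ℝ) := by exact_mod_cast (by omega : 0 < ⌈Skeleton.P1 D⌉₊)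
  calc Real.log (((⌈Skeleton.P1 D⌉₊ : ℕ) : ℝ)) ≤ Real.log (2 * Skeleton.P1 D) :=
        Real.log_le_log hpos hceil
    _ = Real.log 2 + 0.504 * ell D ^ 9 := by
        rw [Real.log_mul (by norm_num) (by rw [hP1]; exact (Real.exp_pos _).ne'), hP1, Real.log_exp]
    _ ≤ ell D ^ 9 := by
        have := Real.log_two_lt_d9; norm_num at this; nlinarith

/-- **The part `r ≥ D` of the (7.13)-sum**, for `1 ≤ d, h < ⌈P₁⌉` summed: at most
`54·M₅·C₃·P²·𝓛⁸¹·D^{−c₃}` (`M₅ = majorantConst 5 5`), GIVEN the (7.15)-bound for this `D` and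
`𝓛 ≥ 2` (dyadic blocks via `blocks713_le`, then `Σ_d τ₅(d)/d ≤ M₅(log⌈P₁⌉)⁵`, `Σ_h 1/h ≤ 1 + log⌈P₁⌉`,
`#blocks ≤ log₂⌈P₁⌉ + 1`, `log⌈P₁⌉ ≤ 𝓛⁹`).
[cite: Zhang2022LandauSiegel, §7 (7.13)–(7.15) pp.37–38, tex L2005–L2030] -/
theorem sum_bigR_le (c' : ℝ) {D : ℕ} (a₁ : ℕ → ℂ) {C₃' c₃ : ℝ} (hC₃'0 : 0 ≤ C₃') (hD0 : 0 < D)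
    (hℓ2 : 2 ≤ ell D)
    (h3 : ∀ (d h : ℕ) (R : ℝ), 0 < d → 0 < h → InRange735 D d h R →
      R ^ (-(3 / 2 : ℝ)) * ∑ r ∈ dyadic R, ∑ θ : DirichletCharacter ℂ r,
          (if θ.IsPrimitive then ‖frakS c' D a₁ r h d θ‖ else 0) ≤
        C₃' * MeanSquareMajorant.tau 5 d * (h : ℝ) * bigP D ^ 2 * (D : ℝ) ^ (-c₃)) :
    ∑ x ∈ (tripleSet D).filter (fun x => ¬ x.2.2 < D), term713 c' D a₁ x ≤
      54 * MeanSquareMajorant.majorantConst 5 5 * C₃' * bigP D ^ 2 * ell D ^ 81 * (D : ℝ) ^ (-c₃) := by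
  have hDpos : (0 : ℝ) < D := by exact_mod_cast hD0
  set M₅ : ℝ := MeanSquareMajorant.majorantConst 5 5 with hM₅
  have hM₅0 : 0 < M₅ := MeanSquareMajorant.majorantConst_pos 5 5
  set N₁ : ℕ := ⌈Skeleton.P1 D⌉₊ with hN₁
  set T := tripleSet D with hT
  obtain ⟨hlogN, hN3⟩ := log_ceil_P1_le hℓ2
  -- rewrite as `Σ_d Σ_h Σ_{r ∈ B'(d,h)}`
  have hset : T.filter (fun x => ¬ x.2.2 < D) =
      ((Finset.Ico 1 N₁) ×ˢ ((Finset.Ico 1 N₁) ×ˢ (Finset.Ico 2 N₁))).filter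
        (fun x => ((x.1 * x.2.1 * x.2.2 : ℕ) : ℝ) < Skeleton.P1 D ∧ ¬ x.2.2 < D) := by
    rw [hT, tripleSet, Finset.filter_filter]
  rw [hset, Finset.sum_filter, Finset.sum_product, Finset.sum_congr rfl
    (fun d _ => Finset.sum_product (s := Finset.Ico 1 N₁) (t := Finset.Ico 2 N₁)
      (f := fun y => if ((( d * y.1 * y.2 : ℕ) : ℝ) < Skeleton.P1 D ∧ ¬ y.2 < D)
        then term713 c' D a₁ (d, y) else 0))]
  -- bound each `(d,h)`-sum by the blocks bound
  have hdh : ∀ d ∈ Finset.Ico 1 N₁, ∀ h ∈ Finset.Ico 1 N₁,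
      ∑ r ∈ Finset.Ico 2 N₁, (if (((d * h * r : ℕ) : ℝ) < Skeleton.P1 D ∧ ¬ r < D)
          then term713 c' D a₁ (d, h, r) else 0) ≤
        ((Nat.log 2 N₁ : ℕ) + 1 : ℝ) *
          ((1 + Real.log (((N₁ : ℕ) : ℝ) ^ 2)) ^ 2 * C₃' * MeanSquareMajorant.tau 5 d *
            bigP D ^ 2 * (D : ℝ) ^ (-c₃) / ((d : ℝ) * h)) := by
    intro d hd h hh
    rw [← Finset.sum_filter]
    exact blocks713_le c' a₁ hC₃'0 hD0 h3 hd hh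
  refine (Finset.sum_le_sum fun d hd => Finset.sum_le_sum fun h hh => hdh d hd h hh).trans ?_
  -- factor the `(d,h)`-sums
  have hfac : ∑ d ∈ Finset.Ico 1 N₁, ∑ h ∈ Finset.Ico 1 N₁,
      ((Nat.log 2 N₁ : ℕ) + 1 : ℝ) *
        ((1 + Real.log (((N₁ : ℕ) : ℝ) ^ 2)) ^ 2 * C₃' * MeanSquareMajorant.tau 5 d *
          bigP D ^ 2 * (D : ℝ) ^ (-c₃) / ((d : ℝ) * h)) =
      ((Nat.log 2 N₁ : ℕ) + 1 : ℝ) * (1 + Real.log (((N₁ : ℕ) : ℝ) ^ 2)) ^ 2 * C₃' *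
        bigP D ^ 2 * (D : ℝ) ^ (-c₃) *
        ((∑ d ∈ Finset.Ico 1 N₁, MeanSquareMajorant.tau 5 d / d) *
          ∑ h ∈ Finset.Ico 1 N₁, (1 : ℝ) / h) := by
    rw [Finset.sum_mul_sum, Finset.mul_sum]
    refine Finset.sum_congr rfl fun d hd => ?_
    rw [Finset.mul_sum]
    refine Finset.sum_congr rfl fun h hh => ?_
    rw [Finset.mem_Ico] at hd hh
    have hd0 : (d : ℝ) ≠ 0 := by exact_mod_cast (by omega : d ≠ 0)
    have hh0 : (h : ℝ) ≠ 0 := by exact_mod_cast (by omega : h ≠ 0)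
    field_simp
  rw [hfac]
  -- the elementary sums and logs
  have hτ : ∑ d ∈ Finset.Ico 1 N₁, MeanSquareMajorant.tau 5 d / d ≤ M₅ * Real.log N₁ ^ 5 :=
    sum_Ico_tau_five_div_le hN3
  have hharm : ∑ h ∈ Finset.Ico 1 N₁, (1 : ℝ) / h ≤ 1 + Real.log N₁ := sum_Ico_inv_le_one_add_log N₁
  have hτ0 : 0 ≤ ∑ d ∈ Finset.Ico 1 N₁, MeanSquareMajorant.tau 5 d / d :=
    Finset.sum_nonneg fun d _ => div_nonneg (MeanSquareMajorant.tau_nonneg 5 d) (Nat.cast_nonneg d)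
  have hh0 : 0 ≤ ∑ h ∈ Finset.Ico 1 N₁, (1 : ℝ) / h :=
    Finset.sum_nonneg fun h _ => div_nonneg zero_le_one (Nat.cast_nonneg h)
  set L9 : ℝ := ell D ^ 9 with hL9
  have hL9one : 1 ≤ L9 := by rw [hL9]; exact one_le_pow₀ (by linarith)
  have hlog0 : 0 ≤ Real.log N₁ := Real.log_natCast_nonneg N₁
  -- `I + 1 ≤ 3 L9`
  have hI : ((Nat.log 2 N₁ : ℕ) + 1 : ℝ) ≤ 3 * L9 := by
    have h2I : ((2 : ℕ) ^ Nat.log 2 N₁ : ℕ) ≤ N₁ := Nat.pow_log_le_self 2 (by omega)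
    have h2I' : (2 : ℝ) ^ (Nat.log 2 N₁) ≤ N₁ := by exact_mod_cast h2I
    have hlog2 : (Nat.log 2 N₁ : ℝ) * Real.log 2 ≤ Real.log N₁ := by
      rw [← Real.log_pow]
      exact Real.log_le_log (by positivity) h2I'
    have hl2 : (1 / 2 : ℝ) < Real.log 2 := by have := Real.log_two_gt_d9; norm_num at this; linarith
    have : (Nat.log 2 N₁ : ℝ) ≤ 2 * Real.log N₁ := by
      have hI0 : (0 : ℝ) ≤ Nat.log 2 N₁ := Nat.cast_nonneg _
      nlinarith
    linarith
  -- `Λ ≤ 9 L9²`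
  have hΛ : (1 + Real.log (((N₁ : ℕ) : ℝ) ^ 2)) ^ 2 ≤ 9 * L9 ^ 2 := by
    rw [Real.log_pow, Nat.cast_ofNat]
    have : 1 + 2 * Real.log N₁ ≤ 3 * L9 := by linarith
    calc (1 + 2 * Real.log (N₁ : ℝ)) ^ 2 ≤ (3 * L9) ^ 2 :=
          pow_le_pow_left₀ (by linarith) this 2
      _ = 9 * L9 ^ 2 := by ring
  have hτ' : ∑ d ∈ Finset.Ico 1 N₁, MeanSquareMajorant.tau 5 d / d ≤ M₅ * L9 ^ 5 :=
    hτ.trans (mul_le_mul_of_nonneg_left (pow_le_pow_left₀ hlog0 hlogN 5) hM₅0.le)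
  have hharm' : ∑ h ∈ Finset.Ico 1 N₁, (1 : ℝ) / h ≤ 2 * L9 := by linarith
  have hP2 : 0 ≤ bigP D ^ 2 * (D : ℝ) ^ (-c₃) :=
    mul_nonneg (pow_nonneg (Real.exp_pos _).le 2) (Real.rpow_nonneg hDpos.le _)
  calc ((Nat.log 2 N₁ : ℕ) + 1 : ℝ) * (1 + Real.log (((N₁ : ℕ) : ℝ) ^ 2)) ^ 2 * C₃' *
        bigP D ^ 2 * (D : ℝ) ^ (-c₃) *
        ((∑ d ∈ Finset.Ico 1 N₁, MeanSquareMajorant.tau 5 d / d) *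
          ∑ h ∈ Finset.Ico 1 N₁, (1 : ℝ) / h)
      ≤ (3 * L9) * (9 * L9 ^ 2) * C₃' * bigP D ^ 2 * (D : ℝ) ^ (-c₃) *
          ((M₅ * L9 ^ 5) * (2 * L9)) := by
        have hA : ((Nat.log 2 N₁ : ℕ) + 1 : ℝ) * (1 + Real.log (((N₁ : ℕ) : ℝ) ^ 2)) ^ 2 ≤
            (3 * L9) * (9 * L9 ^ 2) := mul_le_mul hI hΛ (sq_nonneg _) (by positivity)
        have hB : (∑ d ∈ Finset.Ico 1 N₁, MeanSquareMajorant.tau 5 d / d) *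
            ∑ h ∈ Finset.Ico 1 N₁, (1 : ℝ) / h ≤ (M₅ * L9 ^ 5) * (2 * L9) :=
          mul_le_mul hτ' hharm' hh0 (by positivity)
        have hA0 : 0 ≤ ((Nat.log 2 N₁ : ℕ) + 1 : ℝ) * (1 + Real.log (((N₁ : ℕ) : ℝ) ^ 2)) ^ 2 := by
          positivity
        calc _ = (((Nat.log 2 N₁ : ℕ) + 1 : ℝ) * (1 + Real.log (((N₁ : ℕ) : ℝ) ^ 2)) ^ 2) *
              (C₃' * (bigP D ^ 2 * (D : ℝ) ^ (-c₃))) *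
              ((∑ d ∈ Finset.Ico 1 N₁, MeanSquareMajorant.tau 5 d / d) *
                ∑ h ∈ Finset.Ico 1 N₁, (1 : ℝ) / h) := by ring
          _ ≤ ((3 * L9) * (9 * L9 ^ 2)) * (C₃' * (bigP D ^ 2 * (D : ℝ) ^ (-c₃))) *
              ((M₅ * L9 ^ 5) * (2 * L9)) := by
              apply mul_le_mul (mul_le_mul_of_nonneg_right hA (mul_nonneg hC₃'0 hP2)) hB
                (mul_nonneg hτ0 hh0) (by positivity)
          _ = _ := by ring
    _ = 54 * M₅ * C₃' * bigP D ^ 2 * ell D ^ 81 * (D : ℝ) ^ (-c₃) := by rw [hL9]; ring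

/-- **The edge "(7.13) ∧ [terms `1 < r < D`] ∧ (7.15) ⇒ (7.11)"** (the closing bookkeeping of
"*Proof of Proposition 7.1: The error term*", §7 p. 38, tex L2022–L2030), in the stub form
`Iface.Eq711` of slice L2-t4: for `D` large, `‖Σ_{p∼P}p^{β₃}𝔗₁₂(p)‖ ≤ C₁·Σ′_{d,h,r}(…)` by (7.13);
the triples with `r < D` contribute `≤ C₁C₂P²D^{−c₂}`; those with `r ≥ D` are covered, for each
`(d,h)`, by the dyadic blocks `R = D·2^i` (`i ≤ log₂⌈P₁⌉`), each contributing
`≤ Λ·C₃τ₅(d)P²D^{−c₃}/(dh)` by (7.15) (`blocks713_le`), and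
`Σ_{d,h<⌈P₁⌉} τ₅(d)/(dh) ≤ M₅(log⌈P₁⌉)⁵(1 + log⌈P₁⌉)`; with `log⌈P₁⌉ ≤ 𝓛⁹` the total is
`≤ C₁(C₂ + 54M₅C₃𝓛⁸¹)P²D^{−c}`, which is `≤ ε𝔓` since `𝔓 ≥ ½P²𝓛⁻⁷⁷` ((2.9), `frakP_bounds`) and
`𝓛^kD^{−c} → 0`. [cite: Zhang2022LandauSiegel, §7 (7.11)/(7.13)/(7.15) pp.37–38, tex L2005–L2030] -/
theorem eq711_of (c' : ℝ) (h713 : Eq713 c') (hsmall : Step7bSmallR c') (h715 : Eq715 c') :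
    Iface.Eq711 c' := by
  intro B ε hε
  obtain ⟨C₁, h713'⟩ := h713 B
  obtain ⟨c₂, hc₂, C₂, hsmall'⟩ := hsmall B
  obtain ⟨c₃, hc₃, C₃, h715'⟩ := h715 B
  set C₁' : ℝ := max C₁ 0 with hC₁'
  set C₂' : ℝ := max C₂ 0 with hC₂'
  set C₃' : ℝ := max C₃ 0 with hC₃'
  set M₅ : ℝ := MeanSquareMajorant.majorantConst 5 5 with hM₅
  have hC₁'0 : 0 ≤ C₁' := le_max_right _ _
  have hC₂'0 : 0 ≤ C₂' := le_max_right _ _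
  have hC₃'0 : 0 ≤ C₃' := le_max_right _ _
  have hM₅0 : 0 < M₅ := MeanSquareMajorant.majorantConst_pos 5 5
  -- thresholds
  obtain ⟨DP, hDP⟩ := frakP_bounds
  obtain ⟨D₂, hD₂⟩ := ell_pow_mul_rpow_neg_eventually 77 hc₂ (η := ε / 4) (by positivity)
    (2 * (C₁' * C₂'))
  obtain ⟨D₃, hD₃⟩ := ell_pow_mul_rpow_neg_eventually 158 hc₃ (η := ε / 4) (by positivity)
    (2 * (C₁' * (54 * M₅ * C₃')))
  have hev : ForAllLarge fun D _ _ => DP ≤ D ∧ D₂ ≤ D ∧ D₃ ≤ D ∧ 2 ≤ ell D := by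
    refine ForAllLarge.of_le (max (max DP D₂) (max D₃ ⌈Real.exp 2⌉₊)) fun D _ _ hD _ _ => ?_
    have h1 : max DP D₂ ≤ D := le_trans (le_max_left _ _) hD
    have h2 : max D₃ ⌈Real.exp 2⌉₊ ≤ D := le_trans (le_max_right _ _) hD
    refine ⟨le_trans (le_max_left _ _) h1, le_trans (le_max_right _ _) h1,
      le_trans (le_max_left _ _) h2, ?_⟩
    have hexp : Real.exp 2 ≤ D :=
      le_trans (Nat.le_ceil _) (by exact_mod_cast le_trans (le_max_right _ _) h2)
    rw [ell]
    exact (Real.le_log_iff_exp_le (lt_of_lt_of_le (Real.exp_pos _) hexp)).mpr hexp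
  refine ((h713'.and (hsmall'.and h715')).and hev).mono ?_
  intro D _ χ _ _ hh hA a₁ a₂ ha₁ ha₂
  obtain ⟨⟨H713, Hsmall, H715⟩, hDP', hD₂', hD₃', hℓ2⟩ := hh
  have hD0 : 0 < D := Nat.pos_of_ne_zero (NeZero.ne D)
  have hDpos : (0 : ℝ) < D := by exact_mod_cast hD0
  -- the three hypotheses at this `D`
  have h1 := H713 hA a₁ a₂ ha₁ ha₂
  have h2 := Hsmall hA a₁ ha₁
  have h3 : ∀ (d h : ℕ) (R : ℝ), 0 < d → 0 < h → InRange735 D d h R →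
      R ^ (-(3 / 2 : ℝ)) * ∑ r ∈ dyadic R, ∑ θ : DirichletCharacter ℂ r,
          (if θ.IsPrimitive then ‖frakS c' D a₁ r h d θ‖ else 0) ≤
        C₃' * MeanSquareMajorant.tau 5 d * (h : ℝ) * bigP D ^ 2 * (D : ℝ) ^ (-c₃) := by
    intro d h R hd hh hR
    refine (H715 hA a₁ ha₁ d h R hd hh hR).trans ?_
    have : 0 ≤ MeanSquareMajorant.tau 5 d * (h : ℝ) * bigP D ^ 2 * (D : ℝ) ^ (-c₃) := by
      have := MeanSquareMajorant.tau_nonneg 5 d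
      have := Real.rpow_nonneg hDpos.le (-c₃)
      positivity
    calc C₃ * MeanSquareMajorant.tau 5 d * (h : ℝ) * bigP D ^ 2 * (D : ℝ) ^ (-c₃)
        = C₃ * (MeanSquareMajorant.tau 5 d * (h : ℝ) * bigP D ^ 2 * (D : ℝ) ^ (-c₃)) := by ring
      _ ≤ C₃' * (MeanSquareMajorant.tau 5 d * (h : ℝ) * bigP D ^ 2 * (D : ℝ) ^ (-c₃)) :=
          mul_le_mul_of_nonneg_right (le_max_left _ _) this
      _ = C₃' * MeanSquareMajorant.tau 5 d * (h : ℝ) * bigP D ^ 2 * (D : ℝ) ^ (-c₃) := by ring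
  -- abbreviations
  set N₁ : ℕ := ⌈Skeleton.P1 D⌉₊ with hN₁
  set T := tripleSet D with hT
  have hterm0 : ∀ x, 0 ≤ term713 c' D a₁ x := by
    intro x
    unfold term713
    refine mul_nonneg (inv_nonneg.mpr (by positivity)) (Finset.sum_nonneg fun θ _ => ?_)
    split_ifs
    · exact norm_nonneg _
    · exact le_rfl
  -- split at `r < D`
  have hsplit : ∑ x ∈ T, term713 c' D a₁ x =
      ∑ x ∈ T.filter (fun x => x.2.2 < D), term713 c' D a₁ x +
        ∑ x ∈ T.filter (fun x => ¬ x.2.2 < D), term713 c' D a₁ x :=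
    (Finset.sum_filter_add_sum_filter_not _ _ _).symm
  -- the `r ≥ D` part (dyadic blocks)
  have hbig : ∑ x ∈ T.filter (fun x => ¬ x.2.2 < D), term713 c' D a₁ x ≤
      54 * M₅ * C₃' * bigP D ^ 2 * ell D ^ 81 * (D : ℝ) ^ (-c₃) :=
    sum_bigR_le c' a₁ hC₃'0 hD0 hℓ2 h3
  -- the `r < D` part
  have hsmallD : ∑ x ∈ T.filter (fun x => x.2.2 < D), term713 c' D a₁ x ≤
      C₂' * bigP D ^ 2 * (D : ℝ) ^ (-c₂) := by
    refine h2.trans ?_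
    have : 0 ≤ bigP D ^ 2 * (D : ℝ) ^ (-c₂) :=
      mul_nonneg (pow_nonneg (Real.exp_pos _).le 2) (Real.rpow_nonneg hDpos.le _)
    calc C₂ * bigP D ^ 2 * (D : ℝ) ^ (-c₂) = C₂ * (bigP D ^ 2 * (D : ℝ) ^ (-c₂)) := by ring
      _ ≤ C₂' * (bigP D ^ 2 * (D : ℝ) ^ (-c₂)) := mul_le_mul_of_nonneg_right (le_max_left _ _) this
      _ = C₂' * bigP D ^ 2 * (D : ℝ) ^ (-c₂) := by ring
  -- the lower bound for `𝔓`
  have hfrakP : bigP D ^ 2 * (ell D ^ 77)⁻¹ / 2 ≤ frakP D := by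
    have hP := hDP D hDP'
    change |frakP D - bigP D ^ 2 * (ell D ^ 77)⁻¹| ≤
      3 * (ell D ^ 68)⁻¹ * (bigP D ^ 2 * (ell D ^ 77)⁻¹) at hP
    have hℓ68 : (2 ^ 68 : ℝ) ≤ ell D ^ 68 := pow_le_pow_left₀ (by norm_num) hℓ2 68
    have h3 : 3 * (ell D ^ 68)⁻¹ ≤ 1 / 2 := by
      rw [show 3 * (ell D ^ 68)⁻¹ = 3 / ell D ^ 68 by ring, div_le_iff₀ (by positivity)]
      nlinarith
    have hX : 0 ≤ bigP D ^ 2 * (ell D ^ 77)⁻¹ := by positivity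
    have h4 : 3 * (ell D ^ 68)⁻¹ * (bigP D ^ 2 * (ell D ^ 77)⁻¹) ≤
        1 / 2 * (bigP D ^ 2 * (ell D ^ 77)⁻¹) := mul_le_mul_of_nonneg_right h3 hX
    have h5 := (abs_le.mp hP).1
    linarith
  -- conclusion
  have hsum : ∑ x ∈ T, term713 c' D a₁ x ≤
      C₂' * bigP D ^ 2 * (D : ℝ) ^ (-c₂) + 54 * M₅ * C₃' * bigP D ^ 2 * ell D ^ 81 * (D : ℝ) ^ (-c₃) := by
    rw [hsplit]; exact add_le_add hsmallD hbig
  have hS0 : 0 ≤ ∑ x ∈ T, term713 c' D a₁ x := Finset.sum_nonneg fun x _ => hterm0 x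
  have hε₂ := hD₂ D hD₂'
  have hε₃ := hD₃ D hD₃'
  have hℓpos : 0 < ell D := by linarith
  set X : ℝ := bigP D ^ 2 * (ell D ^ 77)⁻¹ / 2 with hX
  have hX0 : 0 ≤ X := by positivity
  have hP2 : bigP D ^ 2 = 2 * X * ell D ^ 77 := by
    have h77 : ell D ^ 77 ≠ 0 := by positivity
    calc bigP D ^ 2 = bigP D ^ 2 * ((ell D ^ 77)⁻¹ * ell D ^ 77) := by
          rw [inv_mul_cancel₀ h77, mul_one]
      _ = 2 * X * ell D ^ 77 := by rw [hX]; ring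
  calc ‖∑ p ∈ primeWindow D, (p : ℂ) ^ beta3 c' D * Iface.frakT12 c' D p a₁ a₂‖
      ≤ C₁ * ∑ x ∈ T, term713 c' D a₁ x := h1
    _ ≤ C₁' * ∑ x ∈ T, term713 c' D a₁ x := mul_le_mul_of_nonneg_right (le_max_left _ _) hS0
    _ ≤ C₁' * (C₂' * bigP D ^ 2 * (D : ℝ) ^ (-c₂) +
          54 * M₅ * C₃' * bigP D ^ 2 * ell D ^ 81 * (D : ℝ) ^ (-c₃)) :=
        mul_le_mul_of_nonneg_left hsum hC₁'0
    _ = X * ((2 * (C₁' * C₂')) * ell D ^ 77 * (D : ℝ) ^ (-c₂) +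
            (2 * (C₁' * (54 * M₅ * C₃'))) * ell D ^ 158 * (D : ℝ) ^ (-c₃)) := by
        rw [hP2]; ring
    _ ≤ X * (ε / 4 + ε / 4) := mul_le_mul_of_nonneg_left (add_le_add hε₂ hε₃) hX0
    _ ≤ frakP D * (ε / 4 + ε / 4) := mul_le_mul_of_nonneg_right hfrakP (by positivity)
    _ ≤ ε * frakP D := by nlinarith [frakP_nonneg D]

/-- The same edge with the OWNER's (7.11) (`Section7bStatements.Eq711`) as conclusion.
[cite: Zhang2022LandauSiegel, §7 (7.11) p.37, tex L1980] -/
theorem eq711'_of (c' : ℝ) (h713 : Eq713 c') (hsmall : Step7bSmallR c') (h715 : Eq715 c') :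
    Section7bStatements.Eq711 c' :=
  (Iface.eq711_iff c').mp (eq711_of c' h713 hsmall h715)

/-- **The deduction node `Z22:Prop7.1.pf.b-error` AS TYPED** (`DedProp71b c′`: (7.12), `|τ(θ̄)| ≤ √r`,
§7.u031, (7.13), the `l > P²` truncation, (7.14), §7.u033, §7.u034, the `1 < r < D` total, (7.15)
`⇒` (7.11)) HOLDS: of its ten antecedents the conclusion needs only (7.13), the `1 < r < D` total
and (7.15) (`eq711_of`); the others are the printed route TO those three (slice L2-t4's edges
`step7u034_of`, `ded715_holds`, …). [cite: Zhang2022LandauSiegel, §7 pp.37–39, tex L1984–L2058] -/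
theorem dedProp71b_holds (c' : ℝ) : DedProp71b c' :=
  fun _ _ _ h713 _ _ _ _ hsmall h715 => eq711_of c' h713 hsmall h715

end Literature.NumberTheory.LFunctions.Zhang2022.Section7cStatements
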